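import Mathlib
import Literature.Analysis.FunctionSpaces.SobolevDomain
import Summits.NavierStokesRegularity.NavierStokesRegularity.Theorems.L3TimeExponentPincerSwirlFreeLimit
import HarnessLib.Audit
import HarnessLib

/-!
# L3TimeExponentPincer — from weak convergence against vector test fields to the scalar `g •` form

Support kernel for the crux `L3CascadeJaw` (item stmt-NavierStokesRegularity-19499) of route
`L3TimeExponentPincer`; glue for step 3 of the (J) reduction of planner nsreg-p2's ROUND-12 §2b
(blueprint attached to the item).  The compactness fact `jia_sverak_leray_weak_stability(_holds)`
reports the weak `L³` convergence of the data against VECTOR test fields,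
`∫ ⟪a_k, φ⟫ → ∫ ⟪a', φ⟫` for `φ ∈ C_c^∞(ℝ³; ℝ³)` (`FunctionSpaces.IsTestFunctionOn ⊤ φ`), whereas
the landed symmetry-passage lemmas (`…RecedingAxis`, `…ConvergingAxes`, `…SwirlFreeLimit`) consume
`∫ g • a_k → ∫ g • a'` for scalar `g ∈ C_c^∞(ℝ³; ℝ)`.

* `isTestFunctionOn_smul_single` — `g • e_i` is a vector test field for a scalar test function `g`;
* `inner_smul_single` — `⟪v, g • e_i⟫ = g · v_i`;
* **`tendsto_integral_smul_of_tendsto_integral_inner`** — the conversion (componentwise, then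
  reassembled in `EuclideanSpace ℝ (Fin 3)`).

WHAT THIS IS NOT: not NS regularity or blow-up; bookkeeping; the crux `L3CascadeJaw` is untouched;
no crux claim.
-/

noncomputable section

open MeasureTheory Set Function Filter Topology
open scoped ENNReal NNReal ContDiff RealInnerProductSpace

namespace Summit.NavierStokesRegularity.NavierStokesRegularity.Theorems.L3TimeExponentPincerVectorTestConvergence

open Literature.Analysis
open Summit.NavierStokesRegularity.NavierStokesRegularity.Theorems.L3TimeExponentPincerSwirlFreeLimit

/-- For a scalar test function `g`, the field `x ↦ g x • e_i` is a vector test field on `ℝ³`. -/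
theorem isTestFunctionOn_smul_single {g : EuclideanSpace ℝ (Fin 3) → ℝ} (hg : ContDiff ℝ ∞ g)
    (hgs : HasCompactSupport g) (i : Fin 3) :
    FunctionSpaces.IsTestFunctionOn (⊤ : TopologicalSpace.Opens (EuclideanSpace ℝ (Fin 3)))
      (fun x => g x • EuclideanSpace.single i (1 : ℝ)) where
  contDiff := hg.smul contDiff_const
  hasCompactSupport := hgs.smul_right
  tsupport_subset := fun _ _ => trivial

/-- `⟪v, g • e_i⟫ = g · v_i`. -/
theorem inner_smul_single (v : EuclideanSpace ℝ (Fin 3)) (c : ℝ) (i : Fin 3) :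
    ⟪v, c • EuclideanSpace.single i (1 : ℝ)⟫ = c * v i := by
  rw [real_inner_smul_right, EuclideanSpace.inner_single_right]
  simp

/-- **Weak convergence against vector test fields gives the scalar `g •` form.**  If
`∫ ⟪a_k, φ⟫ → ∫ ⟪a', φ⟫` for every vector test field `φ` on `ℝ³` and all fields are locally
integrable, then `∫ g • a_k → ∫ g • a'` (vector integrals) for every `g ∈ C_c^∞(ℝ³; ℝ)`. -/
theorem tendsto_integral_smul_of_tendsto_integral_inner
    {a : ℕ → EuclideanSpace ℝ (Fin 3) → EuclideanSpace ℝ (Fin 3)}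
    {al : EuclideanSpace ℝ (Fin 3) → EuclideanSpace ℝ (Fin 3)}
    (hak : ∀ k, LocallyIntegrable (a k) volume) (hal : LocallyIntegrable al volume)
    (hconv : ∀ φ : EuclideanSpace ℝ (Fin 3) → EuclideanSpace ℝ (Fin 3),
      FunctionSpaces.IsTestFunctionOn (⊤ : TopologicalSpace.Opens (EuclideanSpace ℝ (Fin 3))) φ →
      Tendsto (fun k => ∫ x, ⟪a k x, φ x⟫) atTop (𝓝 (∫ x, ⟪al x, φ x⟫)))
    {g : EuclideanSpace ℝ (Fin 3) → ℝ} (hg : ContDiff ℝ ∞ g) (hgs : HasCompactSupport g) :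
    Tendsto (fun k => ∫ x, g x • a k x) atTop (𝓝 (∫ x, g x • al x)) := by
  -- componentwise convergence
  have hcomp : ∀ i : Fin 3, Tendsto (fun k => (∫ x, g x • a k x) i) atTop (𝓝 ((∫ x, g x • al x) i)) := by
    intro i
    have h := hconv _ (isTestFunctionOn_smul_single hg hgs i)
    simp only [inner_smul_single] at h
    have ek : ∀ k, (∫ x, g x • a k x) i = ∫ x, g x * a k x i := fun k =>
      integral_smul_apply_eq ((hak k).integrable_smul_left_of_hasCompactSupport hg.continuous hgs) i
    have el : (∫ x, g x • al x) i = ∫ x, g x * al x i :=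
      integral_smul_apply_eq (hal.integrable_smul_left_of_hasCompactSupport hg.continuous hgs) i
    simpa only [ek, el] using h
  -- reassemble in `EuclideanSpace ℝ (Fin 3)` through the homeomorphism with `Fin 3 → ℝ`
  have hpi : Tendsto (fun k => WithLp.ofLp (∫ x, g x • a k x)) atTop (𝓝 (WithLp.ofLp (∫ x, g x • al x))) := by
    rw [tendsto_pi_nhds]
    intro i
    exact hcomp i
  have h2 := ((PiLp.continuous_toLp 2 (fun _ : Fin 3 => ℝ)).tendsto _).comp hpi
  simpa [Function.comp_def] using h2

end Summit.NavierStokesRegularity.NavierStokesRegularity.Theorems.L3TimeExponentPincerVectorTestConvergence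

end
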